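import Summits.QuantumFields.YangMills.Theorems.ScalingWindowSplitCurvatureAmnesiaWilsonSchwingerDyson
import Summits.QuantumFields.GaugeBoot.LatticeWords
import HarnessLib

/-!
# The flow derivative of a word holonomy along the one-link shift (cell `gauge-boot`, Lean task L1, file 2/5)

Honest framing (cell rule): certified bounds on lattice expectations at stated coupling, gauge group, dimension and
torus size; NOT a mass gap, NOT a continuum limit, NOT a string tension; not summit-bearing
(`FixedCouplingUltralocality`, `PerturbativeInvisibility`).

For a matrix representation `ρ : G →* M_N(ℂ)`, an edge `e` of the torus `(ℤ/L)^d`, a matrix `X` and a multiplicative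
family `k : ℝ → G` with `ρ(k t) = exp(tX)` (the setting of the tree's one-link Schwinger–Dyson identity
`Summit.QuantumFields.YangMills.Cruxes.CurvatureAmnesia.WardDefect.SchwingerDyson.integral_shiftDeriv_eq_wilson`), this
file computes the derivative at `t = 0` of `ρ(hol_w(U[e ↦ k(t)U_e]))` for an arbitrary lattice WORD `w`
(`LatticeWords.lean`):
* `insDeriv` — the INSERTION DERIVATIVE, defined by recursion on the word (Leibniz rule); `hasDerivAt_wordHolonomy`
  proves it is the derivative (from the tree's one-factor lemmas `hasDerivAt_factor(_inv)`), `continuous_insDeriv` its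
  continuity in `U`;
* `trace_mul_insDeriv` — the OCCURRENCE EXPANSION `tr(Y·insDeriv) = Σ_k occTerm_k`: `X` is inserted after the prefix at
  every forward traversal of `e` by the `k`-th letter and `−X` before the suffix at every backward traversal (this is
  the split/join bookkeeping of the lattice loop equation, MM-DERIVATION.md §3 of the cell).
Everything is `[folklore]` matrix calculus; no measure theory here.

References: M. Creutz, *Quarks, gluons and lattices* (1983) Ch. 11; S. Chatterjee, arXiv:1502.07719 §3 (Schwinger–Dyson
/ loop equations); cell file `pub-gaugeboot-loop/MM-DERIVATION.md` §§1–3 (conventions: LEFT derivative, tree holonomy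
order).
-/

noncomputable section

open MeasureTheory Filter Topology NormedSpace
open scoped Matrix.Norms.Frobenius Matrix
open Literature.MathematicalPhysics.QuantumFieldTheory
open Summit.QuantumFields.YangMills.Cruxes.CurvatureAmnesia.WardDefect.SchwingerDyson

namespace Summit.QuantumFields.GaugeBoot

variable {d L N : ℕ} {G : Type} [Group G] (ρ : G →* Matrix (Fin N) (Fin N) ℂ) (e : Edge d L)
  (X : Matrix (Fin N) (Fin N) ℂ)

/-- The flow derivative of ONE step factor `ρ(step holonomy)` along the left shift `U ↦ U[e ↦ k(t)U_e]` with
`ρ(k(t)) = exp(tX)`: `X·ρ(U_e)` at a forward traversal of `e`, `ρ(U_e⁻¹)·(−X)` at a backward one, `0` if the step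
does not traverse `e`. [folklore] -/
def stepIns (U : GaugeConfig d L G) (x : Site d L) (s : Step d) : Matrix (Fin N) (Fin N) ℂ :=
  if s.edge x = e then (if s.isFwd then X * ρ (U e) else ρ ((U e)⁻¹) * (-X)) else 0

/-- The INSERTION DERIVATIVE of the word holonomy `ρ(hol_w)` along the one-link shift at `e` in direction `X`:
the Leibniz sum over the letters of `w` (defined by recursion on the word). [folklore] -/
def insDeriv (U : GaugeConfig d L G) : Site d L → Word d → Matrix (Fin N) (Fin N) ℂ
  | _, [] => 0
  | x, s :: w => stepIns ρ e X U x s * ρ (wordHolonomy U (s.apply x) w) +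
      ρ (stepHolonomy U x s) * insDeriv U (s.apply x) w

/-- Unfolding lemma `insDeriv_nil`. [folklore] -/
@[simp] theorem insDeriv_nil (U : GaugeConfig d L G) (x : Site d L) : insDeriv ρ e X U x [] = 0 := rfl

/-- Unfolding lemma `insDeriv_cons`. [folklore] -/
theorem insDeriv_cons (U : GaugeConfig d L G) (x : Site d L) (s : Step d) (w : Word d) :
    insDeriv ρ e X U x (s :: w) = stepIns ρ e X U x s * ρ (wordHolonomy U (s.apply x) w) +
      ρ (stepHolonomy U x s) * insDeriv ρ e X U (s.apply x) w := rfl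

variable {ρ X} {k : ℝ → G}

/-- One step factor is differentiable along the shift, with derivative `stepIns`. [folklore] -/
theorem hasDerivAt_stepHolonomy (hk : ∀ s t, k (s + t) = k s * k t) (hX : ∀ t, ρ (k t) = exp ((t : ℂ) • X))
    (U : GaugeConfig d L G) (x : Site d L) (s : Step d) :
    HasDerivAt (fun t : ℝ => ρ (stepHolonomy (Function.update U e (k t * U e)) x s)) (stepIns ρ e X U x s) 0 := by
  cases s with
  | fwd μ =>
    simpa [stepIns] using hasDerivAt_factor ρ hX e (x, μ) U
  | bwd μ =>
    simpa [stepIns] using hasDerivAt_factor_inv ρ hk hX e (x - Pi.single μ 1, μ) U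

/-- **Leibniz rule for word holonomies**: along the one-link shift the matrix `ρ(hol_w(U))` is differentiable at
`t = 0` with derivative `insDeriv`. [folklore] -/
theorem hasDerivAt_wordHolonomy (hk : ∀ s t, k (s + t) = k s * k t) (hX : ∀ t, ρ (k t) = exp ((t : ℂ) • X))
    (U : GaugeConfig d L G) : ∀ (x : Site d L) (w : Word d),
    HasDerivAt (fun t : ℝ => ρ (wordHolonomy (Function.update U e (k t * U e)) x w)) (insDeriv ρ e X U x w) 0
  | x, [] => by
    simp only [wordHolonomy_nil, map_one, insDeriv_nil]
    exact hasDerivAt_const _ _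
  | x, s :: w => by
    have h1 := hasDerivAt_stepHolonomy (e := e) hk hX U x s
    have h2 := hasDerivAt_wordHolonomy hk hX U (s.apply x) w
    have h := h1.mul h2
    have hz : Function.update U e (k 0 * U e) = U := shift_zero hk e U
    simp only [hz] at h
    refine (h.congr_of_eventuallyEq (Eventually.of_forall fun t => ?_)).congr_deriv ?_
    · simp only [Pi.mul_apply, wordHolonomy_cons, map_mul]
    · rw [insDeriv_cons]


/-! ### Continuity in the configuration -/

section Continuity

variable [TopologicalSpace G] [IsTopologicalGroup G]

omit [IsTopologicalGroup G] in
/-- A step holonomy depends continuously on the configuration (forward step: an evaluation). [folklore] -/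
theorem continuous_stepHolonomy_fwd (x : Site d L) (μ : Fin d) :
    Continuous fun U : GaugeConfig d L G => stepHolonomy U x (.fwd μ) :=
  continuous_apply _

/-- A step holonomy depends continuously on the configuration. [folklore] -/
theorem continuous_stepHolonomy (x : Site d L) (s : Step d) :
    Continuous fun U : GaugeConfig d L G => stepHolonomy U x s := by
  cases s with
  | fwd μ => exact continuous_apply _
  | bwd μ => exact (continuous_apply _).inv

/-- A word holonomy depends continuously on the configuration. [folklore] -/
theorem continuous_wordHolonomy : ∀ (x : Site d L) (w : Word d),
    Continuous fun U : GaugeConfig d L G => wordHolonomy U x w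
  | x, [] => by simpa using continuous_const
  | x, s :: w => by
    simp only [wordHolonomy_cons]
    exact (continuous_stepHolonomy x s).mul (continuous_wordHolonomy (s.apply x) w)

/-- `U ↦ stepIns` is continuous (for continuous `ρ`). [folklore] -/
theorem continuous_stepIns (hρ : Continuous ρ) (x : Site d L) (s : Step d) :
    Continuous fun U : GaugeConfig d L G => stepIns ρ e X U x s := by
  unfold stepIns
  split_ifs
  · exact continuous_const.mul (hρ.comp (continuous_apply e))
  · exact (hρ.comp ((continuous_apply e).inv)).mul continuous_const
  · exact continuous_const

/-- `U ↦ insDeriv` is continuous (for continuous `ρ`). [folklore] -/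
theorem continuous_insDeriv (hρ : Continuous ρ) : ∀ (x : Site d L) (w : Word d),
    Continuous fun U : GaugeConfig d L G => insDeriv ρ e X U x w
  | x, [] => by simpa using continuous_const
  | x, s :: w => by
    simp only [insDeriv_cons]
    exact ((continuous_stepIns (e := e) (X := X) hρ x s).mul (hρ.comp (continuous_wordHolonomy (s.apply x) w))).add
      ((hρ.comp (continuous_stepHolonomy x s)).mul (continuous_insDeriv hρ (s.apply x) w))

end Continuity

/-! ### The occurrence expansion of `tr(Y · insDeriv)` -/

variable (ρ X)

/-- The `k`-th OCCURRENCE TERM of `tr(Y·insDeriv_X hol_w)`: if the `k`-th letter of `w` traverses `e` forward,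
`tr(Y·ρ(hol w[0,k))·X·ρ(hol w[k,n)))`; if backward, `−tr(Y·ρ(hol w[0,k])·X·ρ(hol w(k,n)))`; else `0`. [folklore] -/
def occTerm (Y : Matrix (Fin N) (Fin N) ℂ) (U : GaugeConfig d L G) (x : Site d L) (w : Word d) (k : ℕ) : ℂ :=
  match w[k]? with
  | none => 0
  | some s =>
    if s.edge (Word.siteAt x w k) = e then
      (if s.isFwd then
        (Y * ρ (wordHolonomy U x (w.take k)) * X * ρ (wordHolonomy U (Word.siteAt x w k) (w.drop k))).trace
      else
        -(Y * ρ (wordHolonomy U x (w.take (k + 1))) * X *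
          ρ (wordHolonomy U (Word.siteAt x w (k + 1)) (w.drop (k + 1)))).trace)
    else 0

variable {ρ X}

/-- Shifting the occurrence index past the first letter. [folklore] -/
theorem occTerm_cons_succ (Y : Matrix (Fin N) (Fin N) ℂ) (U : GaugeConfig d L G) (x : Site d L) (s : Step d)
    (w : Word d) (k : ℕ) :
    occTerm ρ e X Y U x (s :: w) (k + 1) = occTerm ρ e X (Y * ρ (stepHolonomy U x s)) U (s.apply x) w k := by
  unfold occTerm
  simp only [List.getElem?_cons_succ, Word.siteAt_succ_cons, List.take_succ_cons, List.drop_succ_cons,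
    wordHolonomy_cons, map_mul, Matrix.mul_assoc]

/-- The occurrence term at the first letter. [folklore] -/
theorem occTerm_cons_zero (Y : Matrix (Fin N) (Fin N) ℂ) (U : GaugeConfig d L G) (x : Site d L) (s : Step d)
    (w : Word d) :
    occTerm ρ e X Y U x (s :: w) 0 = (Y * stepIns ρ e X U x s * ρ (wordHolonomy U (s.apply x) w)).trace := by
  unfold occTerm stepIns
  simp only [List.getElem?_cons_zero, Word.siteAt_zero, List.take_zero, wordHolonomy_nil, map_one,
    List.drop_zero, List.take_succ_cons, wordHolonomy_cons, mul_one, Word.siteAt_succ_cons,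
    List.drop_succ_cons]
  by_cases he : s.edge x = e
  · simp only [he, if_true]
    cases s with
    | fwd μ =>
      simp only [Step.edge_fwd] at he
      simp only [Step.isFwd_fwd, if_true, stepHolonomy_fwd, he, map_mul, Matrix.mul_assoc]
    | bwd μ =>
      simp only [Step.edge_bwd] at he
      simp only [Step.isFwd_bwd, Bool.false_eq_true, if_false, stepHolonomy_bwd, he, Matrix.mul_neg,
        Matrix.neg_mul, Matrix.trace_neg, Matrix.mul_assoc]
  · simp [he]

/-- **Occurrence expansion**: `tr(Y·insDeriv_X hol_w) = Σ_{k<|w|} occTerm_k` — the derivative inserts `X` after the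
prefix at every forward traversal of `e` and `−X` before the suffix at every backward one. [folklore] -/
theorem trace_mul_insDeriv (U : GaugeConfig d L G) : ∀ (Y : Matrix (Fin N) (Fin N) ℂ) (x : Site d L) (w : Word d),
    (Y * insDeriv ρ e X U x w).trace = ∑ k ∈ Finset.range w.length, occTerm ρ e X Y U x w k
  | Y, x, [] => by simp
  | Y, x, s :: w => by
    rw [List.length_cons, Finset.sum_range_succ', occTerm_cons_zero, insDeriv_cons, Matrix.mul_add,
      Matrix.trace_add, ← Matrix.mul_assoc, ← Matrix.mul_assoc,
      trace_mul_insDeriv U (Y * ρ (stepHolonomy U x s)) (s.apply x) w]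
    simp only [occTerm_cons_succ]
    ring

end Summit.QuantumFields.GaugeBoot

end
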